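import Summits.QuantumFields.YangMills.Theorems.FluctuationComparisonRegPrIntLS2BetaFibreTransport
import HarnessLib

/-!
# (RG-K ⊕ WREG) FIBRE TRANSPORT AT A CHARTED BASE POINT: GAP♯ in the FINE variables at a SHIFTED point of the common tube — the LIMIT-INST rows
# `hO0 hmin ha0 hg hg0 hgpos hgrow` for a base point `z₁` that is NOT a fibre point, read through its chart value `Φ (V, z₁)`

Definition-free helper for LINE g18-1 `Cruxes/FluctuationComparisonRegPrIntL/Lines/semiclassical_s2beta.lean` (crux `stmt-QuantumFields-20520`), v11 docking
«DET-REP-A BY NAME ⊕ DET-REP-B displayed» (LINE-OWNER RULING (W3) (2)).  w5-20520 g14's edge supplier `detRepA_edge` and ✓`…LaplaceInstShiftDock.cornerLimit_shift_of_dockFactorised`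
read LIMIT-INST at a SHIFTED base point `σ y₁` of the tube around the corner minimiser `U₀ = σ 0`; their displayed rows there are EXW∕GAP♯ «at `σ y₁`»:
`c.Φ (V, σ y₁) ∈ Sf`, `wilsonAction4 (c.Φ (V, σ y₁)) = m`, and a growth function `g` on the carrier with `ContinuousOn g Xc`, `0 ≤ g`, STRICT positivity off
the `pivotAct`-orbit of `σ y₁`, and `m + g z ≤ wilsonAction4 (c.Φ (V, z))` on `Sf`-charted points.  ✓`…S2BetaFibreTransport.limitInst_exw_gap_rows_of_chartRows`
(px11 g10) produces exactly these rows from the organs when the base point IS the fibre minimiser (`hself : jac (V, U₀) ≠ 0 ∧ Φ (V, U₀) = U₀`).  At a shifted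
point the base `z₁ := σ y₁` is a point of the fine field space whose CHART VALUE `U₁ := Φ (V, z₁)` is the minimising history over the moved datum; `z₁ ≠ U₁`
in general (they differ on the pivots).  THIS FILE is the shifted edition: with `g z := μ′ · ⨅_{w residual} Σ_ℓ dist1 (Φ (V,z) ℓ · (w • U₁)ℓ⁻¹)²` the seven rows
hold at the base point `z₁`, GAP♯ being supplied at the datum `V` for the minimiser `U₁` (which lies in the fibre by the chart's fibre row and in `Sf` with
action `m` by hypothesis — i.e. `U₁ ∈ argminHist V`).  The one new step is `hgpos`: if the orbit distance of `Φ (V, z)` to `U₁` vanishes then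
`Φ (V, z) = w • U₁ = w • Φ (V, z₁)` for a residual `w`, and OFF the pivots `Φ (V, ·)` is the identity at both `z` and `z₁`, so `z = pivotAct (w, h) z₁` with the
pivot factor `h c := z (βₖ c) · (z₁ (βₖ c))⁻¹` — NO equivariance of the chart and NO group-inverse bookkeeping needed.

* §1 ★★ `limitInst_gap_rows_of_chartRows_charted` — abstract chart edition (any `(Φ, jac)` with off-pivot agreement, fibre row and continuity on the carrier `Xc`;
  base point `z₁ ∈ Xc` with `jac (V, z₁) ≠ 0`).
* §2 ★ `limitInst_gap_rows_of_windowChart_charted` — the same for a `WindowChart` `c` with the v8∕v10.1 `ChartRows` carrier `Xc V := {z | c.jac (V, z) ≠ 0}` (the three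
  chart rows as the line displays them), `jac ≠ 0` read off the carrier.

HONEST: bookkeeping over landed letters; proves NO stub of the line — EXW, GAP♯, DET-REP-B∕FOUR-POINT-DECAY, H4ᶜ, LFR♯ᶜ, S2β and crux 20520 stay OPEN; rung R3 (YM₃ on
T³) is NOT d = 4, NOT infinite volume, NOT a mass gap, NOT Clay; the Yang–Mills mass gap is NOT proved.
-/

noncomputable section

open MeasureTheory Filter Topology Set Function
open scoped NNReal
open Literature.MathematicalPhysics.QuantumFieldTheory.Balaban1983to89
open Literature.MathematicalPhysics.QuantumFieldTheory.Balaban1983to89.T3ContinuumYM3Torus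
open Literature.MathematicalPhysics.QuantumFieldTheory.Balaban1983to89.T3UnitLawDensityEML
open Literature.MathematicalPhysics.QuantumFieldTheory.Balaban1983to89.T3UnitScaleTilt
open Literature.MathematicalPhysics.QuantumFieldTheory.Balaban1983to89.T3TiltDescent
open Literature.MathematicalPhysics.QuantumFieldTheory.Balaban1983to89.T3ConstrainedMinimiser (fibre)
open Literature.MathematicalPhysics.QuantumFieldTheory.Balaban1983to89.T4Continuum
open scoped Literature.MathematicalPhysics.QuantumFieldTheory.Balaban1983to89.T3OrbitAverage
open Summit.QuantumFields.YangMills.Theorems.FluctuationComparisonRegPrIntLWregChain (iterCentralBond iterCentralBond_injective)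
open Summit.QuantumFields.YangMills.Theorems.FluctuationComparisonRegPrIntLWregGlue (WindowChart)
open Summit.QuantumFields.YangMills.Theorems.FluctuationComparisonRegPrIntLS2BetaResidualGauge
open Summit.QuantumFields.YangMills.Theorems.FluctuationComparisonRegPrIntLS2BetaResidualGaugeOrbit
open Summit.QuantumFields.YangMills.Theorems.FluctuationComparisonRegPrIntLS2BetaResidualSubgroup
open Summit.QuantumFields.YangMills.Theorems.FluctuationComparisonRegPrIntLS2BetaFibreTransport

namespace Summit.QuantumFields.YangMills.Theorems.FluctuationComparisonRegPrIntLS2BetaFibreTransportCharted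

variable (F : T3Family) {J K : ℕ} (hJK : J ≤ K)

/-! ## §1 The seven LIMIT-INST rows at a charted base point — abstract chart edition -/

/-- ★★ **GAP♯ ⇒ LIMIT-INST's `hO0 hmin ha0 hg hg0 hgpos hgrow` AT A CHARTED BASE POINT.**  Chart `(Φ, jac)` of the window fibration over the datum `V` with, on the
carrier `Xc`, OFF-PIVOT AGREEMENT `Φ (V, z) b = z b` (`b ∉ range βₖ`), the FIBRE ROW `descendTo (Φ (V, z)) = V` and `ContinuousOn (Φ (V, ·)) Xc`; a base point
`z₁ ∈ Xc` with `jac (V, z₁) ≠ 0` whose chart value `U₁ := Φ (V, z₁)` is a minimising `Sf`-history over `V` (`U₁ ∈ Sf`, `wilsonAction4 U₁ = m`); GAP♯'s conclusion at the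
datum for the minimiser `U₁` with constant `μ′ > 0`.  Then, with `g z := μ′ · ⨅_{w residual} Σ_ℓ dist1 (Φ (V,z) ℓ · (w • U₁)ℓ⁻¹)²`: `hO0`, `hmin`, `ha0 : 0 < jac (V, z₁)`,
`hg : ContinuousOn g Xc`, `hg0 : 0 ≤ g` on `Xc`, `hgpos : ∀ z ∈ Xc, (∀ k, pivotAct k z₁ ≠ z) → 0 < g z`, `hgrow : ∀ z ∈ Xc, Φ (V,z) ∈ Sf → m + g z ≤ wilsonAction4 (Φ (V,z))`
— the binder shapes of ✓`…LaplaceInstShift.laplaceLimit_of_charts_tendsto_shift` at `y₁` (`σ y₁ ↦ z₁`).  `hgpos`: a vanishing orbit distance gives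
`Φ (V, z) = w • Φ (V, z₁)` (✓`exists_eq_gaugeAct_of_iInf_le_zero`), hence `z = pivotAct (w, h) z₁` with `h c := z (βₖ c) · (z₁ (βₖ c))⁻¹` by off-pivot agreement at
`z` AND at `z₁`. [cite: Balaban1985Variational, Thm 1 (8)-(10) p.279 and (142) p.299; Balaban1987RG1, (0.4) p.253 and (2.10) p.267] -/
theorem limitInst_gap_rows_of_chartRows_charted
    (Φ : GaugeField (F.P J) 0 (Matrix.specialUnitaryGroup (Fin 2) ℂ) × GaugeField (F.P K) 0 (Matrix.specialUnitaryGroup (Fin 2) ℂ) →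
      GaugeField (F.P K) 0 (Matrix.specialUnitaryGroup (Fin 2) ℂ))
    (jac : GaugeField (F.P J) 0 (Matrix.specialUnitaryGroup (Fin 2) ℂ) × GaugeField (F.P K) 0 (Matrix.specialUnitaryGroup (Fin 2) ℂ) → ℝ≥0)
    {Sf : Set (GaugeField (F.P K) 0 (Matrix.specialUnitaryGroup (Fin 2) ℂ))}
    {V : GaugeField (F.P J) 0 (Matrix.specialUnitaryGroup (Fin 2) ℂ)} {m μ' : ℝ} (hμ' : 0 < μ')
    {Xc : Set (GaugeField (F.P K) 0 (Matrix.specialUnitaryGroup (Fin 2) ℂ))}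
    (hoff : ∀ z ∈ Xc, ∀ b, (∀ c, iterCentralBond (P := F.P K) (K - J) c ≠ b) → Φ (V, z) b = z b)
    (hfib : ∀ z ∈ Xc, descendTo F ℰp J K hJK (Φ (V, z)) = V)
    (hΦc : ContinuousOn (fun z => Φ (V, z)) Xc)
    {z₁ : GaugeField (F.P K) 0 (Matrix.specialUnitaryGroup (Fin 2) ℂ)} (hz₁ : z₁ ∈ Xc) (hjac₁ : jac (V, z₁) ≠ 0)
    (hS₁ : Φ (V, z₁) ∈ Sf) (hm₁ : wilsonAction4 (Φ (V, z₁)) = m)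
    (hgap : ∀ U ∈ fibre F ℰp J K hJK V, U ∈ Sf →
      μ' * ⨅ w : {w : Site (F.P K) 0 → Matrix.specialUnitaryGroup (Fin 2) ℂ |
              ∀ U : GaugeField (F.P K) 0 (Matrix.specialUnitaryGroup (Fin 2) ℂ),
                descendTo F ℰp J K hJK (GaugeField.gaugeAct w U) = descendTo F ℰp J K hJK U},
            ∑ ℓ : PBond (F.P K) 0,
              dist1 (U ℓ * ((GaugeField.gaugeAct (w : Site (F.P K) 0 → Matrix.specialUnitaryGroup (Fin 2) ℂ) (Φ (V, z₁))) ℓ)⁻¹) ^ 2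
        ≤ wilsonAction4 U - m) :
    Φ (V, z₁) ∈ Sf ∧ wilsonAction4 (Φ (V, z₁)) = m ∧ 0 < (jac (V, z₁) : ℝ) ∧
      ContinuousOn (fun z => μ' * ⨅ w : {w : Site (F.P K) 0 → Matrix.specialUnitaryGroup (Fin 2) ℂ |
              ∀ U : GaugeField (F.P K) 0 (Matrix.specialUnitaryGroup (Fin 2) ℂ),
                descendTo F ℰp J K hJK (GaugeField.gaugeAct w U) = descendTo F ℰp J K hJK U},
            ∑ ℓ : PBond (F.P K) 0,
              dist1 (Φ (V, z) ℓ * ((GaugeField.gaugeAct (w : Site (F.P K) 0 → Matrix.specialUnitaryGroup (Fin 2) ℂ) (Φ (V, z₁))) ℓ)⁻¹) ^ 2) Xc ∧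
      (∀ z ∈ Xc, 0 ≤ μ' * ⨅ w : {w : Site (F.P K) 0 → Matrix.specialUnitaryGroup (Fin 2) ℂ |
              ∀ U : GaugeField (F.P K) 0 (Matrix.specialUnitaryGroup (Fin 2) ℂ),
                descendTo F ℰp J K hJK (GaugeField.gaugeAct w U) = descendTo F ℰp J K hJK U},
            ∑ ℓ : PBond (F.P K) 0,
              dist1 (Φ (V, z) ℓ * ((GaugeField.gaugeAct (w : Site (F.P K) 0 → Matrix.specialUnitaryGroup (Fin 2) ℂ) (Φ (V, z₁))) ℓ)⁻¹) ^ 2) ∧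
      (∀ z ∈ Xc, (∀ k : ↥(residualSubgroup F hJK) × (PBond (F.P K) (K - J) → Matrix.specialUnitaryGroup (Fin 2) ℂ),
          pivotAct F hJK (iterCentralBond (P := F.P K) (K - J)) k z₁ ≠ z) →
        0 < μ' * ⨅ w : {w : Site (F.P K) 0 → Matrix.specialUnitaryGroup (Fin 2) ℂ |
              ∀ U : GaugeField (F.P K) 0 (Matrix.specialUnitaryGroup (Fin 2) ℂ),
                descendTo F ℰp J K hJK (GaugeField.gaugeAct w U) = descendTo F ℰp J K hJK U},
            ∑ ℓ : PBond (F.P K) 0,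
              dist1 (Φ (V, z) ℓ * ((GaugeField.gaugeAct (w : Site (F.P K) 0 → Matrix.specialUnitaryGroup (Fin 2) ℂ) (Φ (V, z₁))) ℓ)⁻¹) ^ 2) ∧
      (∀ z ∈ Xc, Φ (V, z) ∈ Sf →
        m + μ' * ⨅ w : {w : Site (F.P K) 0 → Matrix.specialUnitaryGroup (Fin 2) ℂ |
              ∀ U : GaugeField (F.P K) 0 (Matrix.specialUnitaryGroup (Fin 2) ℂ),
                descendTo F ℰp J K hJK (GaugeField.gaugeAct w U) = descendTo F ℰp J K hJK U},
            ∑ ℓ : PBond (F.P K) 0,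
              dist1 (Φ (V, z) ℓ * ((GaugeField.gaugeAct (w : Site (F.P K) 0 → Matrix.specialUnitaryGroup (Fin 2) ℂ) (Φ (V, z₁))) ℓ)⁻¹) ^ 2
          ≤ wilsonAction4 (Φ (V, z))) := by
  classical
  haveI := compactSpace_residualGauge F hJK
  haveI : Nonempty {w : Site (F.P K) 0 → Matrix.specialUnitaryGroup (Fin 2) ℂ |
              ∀ U : GaugeField (F.P K) 0 (Matrix.specialUnitaryGroup (Fin 2) ℂ),
                descendTo F ℰp J K hJK (GaugeField.gaugeAct w U) = descendTo F ℰp J K hJK U} := ⟨⟨1, residual_one F hJK⟩⟩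
  have hk : K - J ≤ (F.P K).m + (F.P K).K := by
    show K - J ≤ F.m + K
    omega
  -- nonnegativity of the orbit infimum at any field
  have hinf0 : ∀ U : GaugeField (F.P K) 0 (Matrix.specialUnitaryGroup (Fin 2) ℂ),
      0 ≤ ⨅ w : {w : Site (F.P K) 0 → Matrix.specialUnitaryGroup (Fin 2) ℂ |
              ∀ U : GaugeField (F.P K) 0 (Matrix.specialUnitaryGroup (Fin 2) ℂ),
                descendTo F ℰp J K hJK (GaugeField.gaugeAct w U) = descendTo F ℰp J K hJK U},
        ∑ ℓ : PBond (F.P K) 0,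
          dist1 (U ℓ * ((GaugeField.gaugeAct (w : Site (F.P K) 0 → Matrix.specialUnitaryGroup (Fin 2) ℂ) (Φ (V, z₁))) ℓ)⁻¹) ^ 2 :=
    fun U => le_ciInf fun w => Finset.sum_nonneg fun ℓ _ => sq_nonneg _
  refine ⟨hS₁, hm₁, ?_, ?_, fun z _ => mul_nonneg hμ'.le (hinf0 _), fun z hz hkz => ?_, fun z hz hzS => ?_⟩
  · -- `ha0`
    exact NNReal.coe_pos.2 (pos_iff_ne_zero.2 hjac₁)
  · -- `hg`
    exact (continuous_const.mul (continuous_iInf_orbitDistSq F hJK (Φ (V, z₁)))).comp_continuousOn hΦc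
  · -- `hgpos`: off the `pivotAct`-orbit of the BASE POINT `z₁` the orbit distance of the chart value to `Φ (V, z₁)` is positive
    refine mul_pos hμ' (lt_of_le_of_ne (hinf0 _) fun h0 => ?_)
    obtain ⟨w, hw, hwU⟩ := exists_eq_gaugeAct_of_iInf_le_zero F hJK (Φ (V, z)) (Φ (V, z₁)) (le_of_eq h0.symm)
    refine hkz (⟨w, hw⟩, fun c => z (iterCentralBond (P := F.P K) (K - J) c) * (z₁ (iterCentralBond (P := F.P K) (K - J) c))⁻¹) ?_
    funext b
    by_cases hb : ∃ c, iterCentralBond (P := F.P K) (K - J) c = b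
    · obtain ⟨c, rfl⟩ := hb
      rw [pivotAct_apply_pivot F hJK _ (iterCentralBond_injective (P := F.P K) hk)]
      show z (iterCentralBond (P := F.P K) (K - J) c) * (z₁ (iterCentralBond (P := F.P K) (K - J) c))⁻¹ *
          z₁ (iterCentralBond (P := F.P K) (K - J) c) = z (iterCentralBond (P := F.P K) (K - J) c)
      rw [inv_mul_cancel_right]
    · rw [pivotAct_apply_of_not_mem_range F hJK _ _ _ hb]
      have hb' : ∀ c, iterCentralBond (P := F.P K) (K - J) c ≠ b := fun c hc => hb ⟨c, hc⟩
      -- off the pivots: `(w • z₁) b = (w • Φ (V, z₁)) b = Φ (V, z) b = z b`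
      show w b.src * z₁ b * (w b.tgt)⁻¹ = z b
      rw [← hoff z₁ hz₁ b hb', ← hoff z hz b hb', hwU]
      rfl
  · -- `hgrow`: GAP♯ at the chart value, which lies in the fibre
    have h := hgap (Φ (V, z)) (hfib z hz) hzS
    linarith

/-! ## §2 The same for a window chart with the `ChartRows` carrier `{z | c.jac (V, z) ≠ 0}` -/

/-- ★ **WINDOW-CHART EDITION.**  For a `WindowChart` `c` over `Sf` on `O` and the carrier `Xc V := {z | c.jac (V, z) ≠ 0}` of LINE g18-1's `ChartRows` (off-pivot agreement,
fibre row, continuity of `c.Φ (V, ·)` on it), a base point `z₁` of the carrier whose chart value is a minimising `Sf`-history of action `m` over `V`, and GAP♯ at `V` for that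
minimiser: the seven LIMIT-INST rows at `z₁` for `c.Φ ∕ c.jac` (§1 with `jac (V, z₁) ≠ 0` read off the carrier). [cite: Balaban1985Variational, Thm 1 (8)-(10) p.279 and (142) p.299;
Balaban1987RG1, (0.4) p.253 and (2.10) p.267] -/
theorem limitInst_gap_rows_of_windowChart_charted
    {Sf : Set (GaugeField (F.P K) 0 (Matrix.specialUnitaryGroup (Fin 2) ℂ))}
    {O : Set (GaugeField (F.P J) 0 (Matrix.specialUnitaryGroup (Fin 2) ℂ))} (c : WindowChart F hJK Sf O)
    {V : GaugeField (F.P J) 0 (Matrix.specialUnitaryGroup (Fin 2) ℂ)} {m μ' : ℝ} (hμ' : 0 < μ')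
    (hoff : ∀ z ∈ {z : GaugeField (F.P K) 0 (Matrix.specialUnitaryGroup (Fin 2) ℂ) | c.jac (V, z) ≠ 0}, ∀ b,
      (∀ c', iterCentralBond (P := F.P K) (K - J) c' ≠ b) → c.Φ (V, z) b = z b)
    (hfib : ∀ z ∈ {z : GaugeField (F.P K) 0 (Matrix.specialUnitaryGroup (Fin 2) ℂ) | c.jac (V, z) ≠ 0}, descendTo F ℰp J K hJK (c.Φ (V, z)) = V)
    (hΦc : ContinuousOn (fun z => c.Φ (V, z)) {z : GaugeField (F.P K) 0 (Matrix.specialUnitaryGroup (Fin 2) ℂ) | c.jac (V, z) ≠ 0})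
    {z₁ : GaugeField (F.P K) 0 (Matrix.specialUnitaryGroup (Fin 2) ℂ)}
    (hz₁ : z₁ ∈ {z : GaugeField (F.P K) 0 (Matrix.specialUnitaryGroup (Fin 2) ℂ) | c.jac (V, z) ≠ 0})
    (hS₁ : c.Φ (V, z₁) ∈ Sf) (hm₁ : wilsonAction4 (c.Φ (V, z₁)) = m)
    (hgap : ∀ U ∈ fibre F ℰp J K hJK V, U ∈ Sf →
      μ' * ⨅ w : {w : Site (F.P K) 0 → Matrix.specialUnitaryGroup (Fin 2) ℂ |
              ∀ U : GaugeField (F.P K) 0 (Matrix.specialUnitaryGroup (Fin 2) ℂ),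
                descendTo F ℰp J K hJK (GaugeField.gaugeAct w U) = descendTo F ℰp J K hJK U},
            ∑ ℓ : PBond (F.P K) 0,
              dist1 (U ℓ * ((GaugeField.gaugeAct (w : Site (F.P K) 0 → Matrix.specialUnitaryGroup (Fin 2) ℂ) (c.Φ (V, z₁))) ℓ)⁻¹) ^ 2
        ≤ wilsonAction4 U - m) :
    c.Φ (V, z₁) ∈ Sf ∧ wilsonAction4 (c.Φ (V, z₁)) = m ∧ 0 < (c.jac (V, z₁) : ℝ) ∧
      ContinuousOn (fun z => μ' * ⨅ w : {w : Site (F.P K) 0 → Matrix.specialUnitaryGroup (Fin 2) ℂ |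
              ∀ U : GaugeField (F.P K) 0 (Matrix.specialUnitaryGroup (Fin 2) ℂ),
                descendTo F ℰp J K hJK (GaugeField.gaugeAct w U) = descendTo F ℰp J K hJK U},
            ∑ ℓ : PBond (F.P K) 0,
              dist1 (c.Φ (V, z) ℓ * ((GaugeField.gaugeAct (w : Site (F.P K) 0 → Matrix.specialUnitaryGroup (Fin 2) ℂ) (c.Φ (V, z₁))) ℓ)⁻¹) ^ 2)
        {z : GaugeField (F.P K) 0 (Matrix.specialUnitaryGroup (Fin 2) ℂ) | c.jac (V, z) ≠ 0} ∧
      (∀ z ∈ {z : GaugeField (F.P K) 0 (Matrix.specialUnitaryGroup (Fin 2) ℂ) | c.jac (V, z) ≠ 0},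
        0 ≤ μ' * ⨅ w : {w : Site (F.P K) 0 → Matrix.specialUnitaryGroup (Fin 2) ℂ |
              ∀ U : GaugeField (F.P K) 0 (Matrix.specialUnitaryGroup (Fin 2) ℂ),
                descendTo F ℰp J K hJK (GaugeField.gaugeAct w U) = descendTo F ℰp J K hJK U},
            ∑ ℓ : PBond (F.P K) 0,
              dist1 (c.Φ (V, z) ℓ * ((GaugeField.gaugeAct (w : Site (F.P K) 0 → Matrix.specialUnitaryGroup (Fin 2) ℂ) (c.Φ (V, z₁))) ℓ)⁻¹) ^ 2) ∧
      (∀ z ∈ {z : GaugeField (F.P K) 0 (Matrix.specialUnitaryGroup (Fin 2) ℂ) | c.jac (V, z) ≠ 0},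
        (∀ k : ↥(residualSubgroup F hJK) × (PBond (F.P K) (K - J) → Matrix.specialUnitaryGroup (Fin 2) ℂ),
          pivotAct F hJK (iterCentralBond (P := F.P K) (K - J)) k z₁ ≠ z) →
        0 < μ' * ⨅ w : {w : Site (F.P K) 0 → Matrix.specialUnitaryGroup (Fin 2) ℂ |
              ∀ U : GaugeField (F.P K) 0 (Matrix.specialUnitaryGroup (Fin 2) ℂ),
                descendTo F ℰp J K hJK (GaugeField.gaugeAct w U) = descendTo F ℰp J K hJK U},
            ∑ ℓ : PBond (F.P K) 0,
              dist1 (c.Φ (V, z) ℓ * ((GaugeField.gaugeAct (w : Site (F.P K) 0 → Matrix.specialUnitaryGroup (Fin 2) ℂ) (c.Φ (V, z₁))) ℓ)⁻¹) ^ 2) ∧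
      (∀ z ∈ {z : GaugeField (F.P K) 0 (Matrix.specialUnitaryGroup (Fin 2) ℂ) | c.jac (V, z) ≠ 0}, c.Φ (V, z) ∈ Sf →
        m + μ' * ⨅ w : {w : Site (F.P K) 0 → Matrix.specialUnitaryGroup (Fin 2) ℂ |
              ∀ U : GaugeField (F.P K) 0 (Matrix.specialUnitaryGroup (Fin 2) ℂ),
                descendTo F ℰp J K hJK (GaugeField.gaugeAct w U) = descendTo F ℰp J K hJK U},
            ∑ ℓ : PBond (F.P K) 0,
              dist1 (c.Φ (V, z) ℓ * ((GaugeField.gaugeAct (w : Site (F.P K) 0 → Matrix.specialUnitaryGroup (Fin 2) ℂ) (c.Φ (V, z₁))) ℓ)⁻¹) ^ 2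
          ≤ wilsonAction4 (c.Φ (V, z))) :=
  limitInst_gap_rows_of_chartRows_charted F hJK c.Φ c.jac hμ' hoff hfib hΦc hz₁ hz₁ hS₁ hm₁ hgap

end Summit.QuantumFields.YangMills.Theorems.FluctuationComparisonRegPrIntLS2BetaFibreTransportCharted

end
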